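import Summits.QuantumFields.YangMills.Theorems.BalabanUVNodesN16OfEdgesAllTorusAtRecord13CoPH
import Summits.QuantumFields.YangMills.Theorems.BalabanUVNodesN16H5OfPSlot

/-!
# Route «BalabanUVNodes», cluster K4 «SpineRates» — node N16 = NE3 AT dag-n22-e's STAGE-13 READING OF RECORD `readingOfRecord₁₃CoPH w1 ℓ₃ ne2 ne1`, WITH NODE N05's
# IN-EDGE READ AS THE TWO P-CONJUNCTS (Theorem 4 ∕ Proposition 3 AS PRINTED on the P-carrier over n05-c's four-law sub-index at N16's objects `(M_N ℂ, 4, F.L)`) —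
# module 37ᴴ `…N16OfEdgesAllTorusAtRecord13CoPH` with its per-family hypothesis `h5` DISCHARGED BY NAME from module 42ᴾ `…N16H5OfPSlot.h5_of_t4P_p3P`

Cell `pub-ymgap`, width seat `pub-ymgap-dag-n16-w2` (g2; director-ym №197 ∕ HUMAN RULING D-0149), node N16.  `--kind proof --supports stmt-QuantumFields-20544 --as helper`
(K3⁷ `SpineGivenEndpointR13SepCoPH`).  `bears_on: R4∕N16 · edge N05 → N16 · out-edge N16 → N27`.

WHY (trigger (t-P), second half).  Module 37ᴴ (`exists_letters_s_N16Holder_readingOfRecord₁₃CoPHOn_of_edges_allTorus`, p545649; dag-n16-e) gives the K3⁷ composer's `h16` from two per-family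
hypotheses: `h5` (node N05's `Thm4Body` ∕ `Prop3Body` at the pinned all-torus members of `zdGF3 (M_N ℂ) F.L β len`, with letters and window) and `h7` (node N07's linear leaf).
Module 42ᴾ (`…N16H5OfPSlot`, this seat) proved `h5 F` from node N05's TWO P-CONJUNCTS — `B8.Thm4Printed B₁'` ∕ `B8.Prop3Printed 4 F.L C₂ inp B₀β` on the P-family
`fun j ↦ zdGF3P (M_N ℂ) F.L β len j.1.1` over the four-law sub-index `{i : {i : ZdIdx 4 F.L // i.Ω 0 = univ} // IdxB8LawsB F.L i.1}` (the `t4P` ∕ `p3P` conjuncts of n05-w1's P-slot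
`Node00.B8LeafOfRecordSubBP` READ AT N16's objects; node N05's γ D-chain suppliers are (𝔸, d, L, ι)-generic and instantiate there) — plus the side letters.  THIS FILE is the
one-line composition: 37ᴴ with `h5 := fun F ↦ h5_of_t4P_p3P …`, in the currency of record R-β (`S_N16Holder β`, the pick of record) and at β = 1 (`S_N16`), at the
regime-restricted reading (`RRec₁₃CoPHOn … Rg`) and at the canonical one (`RRec₁₃CoPH …`).  So the N16 LINE now reads node N05 as «Theorem 4 ∧ Proposition 3 AS PRINTED on
the P-carrier over the four-law sub-index at `(M_N ℂ, 4, F.L)`, some letters `len, B₁′, C₂, B₀β, inp` with the four side letters» — per family, existentially.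

WHAT THIS FILE PROVES (kernel composition BY NAME; 0 `def`, 0 `sorry`): §1 ★ `exists_letters_s_N16Holder_readingOfRecord₁₃CoPHOn_of_pConjuncts_allTorus` (`0 ≤ β ≤ 1`) ·
`exists_letters_s_N16Holder_readingOfRecord₁₃CoPH_of_pConjuncts_allTorus`; §2 `exists_letters_s_N16_readingOfRecord₁₃CoPHOn_of_pConjuncts_allTorus` (β = 1) ·
`exists_letters_s_N16_readingOfRecord₁₃CoPH_of_pConjuncts_allTorus`; §3 (R-β″, MS length letter) `exists_letters_s_N16HolderMS_readingOfRecord₁₃CoPHOn_of_pConjuncts_allTorus` ·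
`exists_letters_s_N16HolderMS_readingOfRecord₁₃CoPH_of_pConjuncts_allTorus` — 37ᴴ's conclusions VERBATIM (letters of record `ℓ₃`, the composer's `h16`, the per-family proviso,
AT-slot and dag-n21-d's numerals), hypotheses `hg`, `h7` VERBATIM, and `hP` := per family `∃ len B₁' C₂ B₀β inp`, side letters ∧ the two P-conjuncts.

HONEST FRAMING.  Composition by name; no estimate; nothing of [Balaban1985RegularSpaces] ∕ [Balaban1985Variational] asserted — `hP` is node N05's ∕ N06's open content
(the γ D-chain; at the pinned members Proposition 3's frame is [Balaban1985BackgroundPropagators] Thm 3.3, N06's), `h7` is node N07's; **N16 ∕ NE3 NOT discharged**;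
count-neutral (typed 28∕28 · discharged 5∕27 UNMOVED); one finite four-torus at fixed ε — NOT ℝ⁴, NOT infinite volume, NOT OS, NOT a mass gap, NOT Clay.
No `sorry`, no `def`, no `instance`, no `notation`.
-/

set_option autoImplicit false

open scoped BigOperators Matrix Matrix.Norms.L2Operator
open NormedSpace

namespace Summit.QuantumFields.YangMills.BalabanUVNodes.N16OfPConjunctsAllTorusAtRecord13CoPH

open Literature.MathematicalPhysics.QuantumFieldTheory.Balaban1983to89
open Literature.MathematicalPhysics.QuantumFieldTheory.Balaban1983to89.T4Continuum (T4Family ULoop)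
open B7Prop1Explicit B7Prop2Explicit
open B8LeafModelZd (ZdIdx)
open B8LeafModelZd3P (zdGF3P)
open B8IdxB8LawsB (IdxB8LawsB)
open Node00 (Stage13HParams NE3Objects₁₁ NE3Letters₁₁ NE2Objects₁₁ ne3ConstLayerOfRecord₁₁ ne3NperOfRecord₁₁ ne3DomOfRecord₁₁ MatA)
open Node00.W1 (ReadingData)
open Summit.QuantumFields.BalabanUV.T4Continuum
open NE3.LeafIndexSockets (LeafH3sup)
open YMDAG.UVSplit (Datum NE3Carriers NE1pCarriers S_N16 ne3OfRecord₁₁ RRec₁₃CoPH RRec₁₃CoPHOn readingOfRecord₁₃CoPH)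
open Summit.QuantumFields.YangMills.BalabanUVNodes.N16Regime (InEndRegime radiusOfRecord constOfRecord)
open Summit.QuantumFields.YangMills.BalabanUVNodes.N16HolderDefs (S_N16Holder)
open Summit.QuantumFields.YangMills.BalabanUVNodes.N16HolderMSDefs (S_N16HolderMS)
open Summit.QuantumFields.YangMills.BalabanUVNodes.N16HolderRegime (InEndRegimeH radiusOfRecordH constOfRecordH)
open Summit.QuantumFields.YangMills.BalabanUVNodes.N16HolderMSRegime (InEndRegimeHMS radiusOfRecordHMS constOfRecordHMS)
open Summit.QuantumFields.YangMills.BalabanUVNodes.N16LeafSlotAllTorus (LeafSlotAT LeafSlotHolderAT LeafSlotHolderMSAT)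
open Summit.QuantumFields.YangMills.BalabanUVNodes.N16OfEdgesAllTorusAtRecord13CoPH (exists_letters_s_N16_readingOfRecord₁₃CoPHOn_of_edges_allTorus
  exists_letters_s_N16_readingOfRecord₁₃CoPH_of_edges_allTorus exists_letters_s_N16Holder_readingOfRecord₁₃CoPHOn_of_edges_allTorus
  exists_letters_s_N16Holder_readingOfRecord₁₃CoPH_of_edges_allTorus exists_letters_s_N16HolderMS_readingOfRecord₁₃CoPHOn_of_edges_allTorus
  exists_letters_s_N16HolderMS_readingOfRecord₁₃CoPH_of_edges_allTorus)
open Summit.QuantumFields.YangMills.BalabanUVNodes.N16H5OfPSlot (h5_of_t4P_p3P h5MS_of_t4P_p3P)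

noncomputable section

variable {N : ℕ} [NeZero N]

/-! ## §1 R-β (the currency of record): `S_N16Holder β`, `0 ≤ β ≤ 1` -/

section Holder

variable {β : ℝ} (hβ0 : 0 ≤ β) (hβ1 : β ≤ 1)
variable (Rg : (F : T4Family) → Stage13HParams F N → Prop)
  (w1 : (F : T4Family) → (θ : Stage13HParams F N) → ReadingData F (MatA N) θ.τ9.M)
  (ne2 : (F : T4Family) → Stage13HParams F N → (ℕ → ℝ) → List (ULoop F) → ℕ → NE2Objects₁₁)
  (ne1 : (F : T4Family) → Stage13HParams F N → (ℕ → ℝ) → List (ULoop F) → NE1pCarriers)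
include hβ0 hβ1

/-- ★ **N16 UNDER R-β AT THE REGIME-RESTRICTED READING OF RECORD, NODE N05 READ AS ITS TWO P-CONJUNCTS** (`0 ≤ β ≤ 1`): per family, SOME letters `len, B₁′, C₂, B₀β, inp` with
the side letters (`len ≥ 1` on its support, `len e_μ = 1`, `0 < B₁′`, `5·4·F.L·B₀ ≤ B₁′`) and node N05's Theorem 4 ∕ Proposition 3 AS PRINTED on the P-family over the four-law
sub-index at `(M_N ℂ, 4, F.L)` (hypothesis `hP`), node N07's linear leaf (`h7`) and a coupling letter `g F > 0` give letters of record `ℓ₃` with the K3⁷ composer's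
`h16 : S_N16Holder β (RRec₁₃CoPHOn (readingOfRecord₁₃CoPH w1 ℓ₃ ne2 ne1) Rg)` AND the per-family proviso, β-slot and numerals — module 37ᴴ with `h5 := h5_of_t4P_p3P` BY NAME.
Nothing of Bałaban is proved: `hP` is node N05's ∕ N06's, `h7` node N07's open content. [cite: Balaban1985RegularSpaces, Thm 4 p.88, Prop. 3 p.87, p.77] [folklore] -/
theorem exists_letters_s_N16Holder_readingOfRecord₁₃CoPHOn_of_pConjuncts_allTorus {g : T4Family → ℝ} (hg : ∀ F, 0 < g F)
    (hP : ∀ F : T4Family, letI : CStarAlgebra (Matrix (Fin N) (Fin N) ℂ) := {}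
      ∃ (len : Site 4 → ℝ) (B₁' C₂ B₀β : ℝ) (inp : B8.B9Inputs),
        (∀ v : Site 4, 0 < len v → 1 ≤ len v) ∧ (∀ μ : Fin 4, len (e μ) = 1) ∧ 0 < B₁' ∧ 5 * ((4 : ℕ) : ℝ) * F.L * inp.B₀ ≤ B₁' ∧
        B8.Thm4Printed B₁' (fun j : {i : {i : ZdIdx 4 F.L // i.Ω 0 = Set.univ} // IdxB8LawsB F.L i.1} => (zdGF3P (Matrix (Fin N) (Fin N) ℂ) F.L β len j.1.1).toGFData) ∧
        B8.Prop3Printed 4 (F.L : ℝ) C₂ inp B₀β (fun j : {i : {i : ZdIdx 4 F.L // i.Ω 0 = Set.univ} // IdxB8LawsB F.L i.1} => (zdGF3P (Matrix (Fin N) (Fin N) ℂ) F.L β len j.1.1).toGFData2))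
    (h7 : ∀ F : T4Family, ∃ C ε₀ : ℝ, 0 ≤ C ∧ 0 < ε₀ ∧ ∀ ε : ℝ, 0 < ε → ε ≤ ε₀ →
      LeafH3sup 4 F.L (ne3NperOfRecord₁₁ F 0 0) ε (C * ε) (C * ε) (ne3DomOfRecord₁₁ F N 0 0)) :
    ∃ ℓ₃ : T4Family → NE3Letters₁₁,
      S_N16Holder β (RRec₁₃CoPHOn (readingOfRecord₁₃CoPH w1 ℓ₃ ne2 ne1) Rg) ∧
      ∀ F : T4Family, (ℓ₃ F).g = g F ∧ (ℓ₃ F).Λ₁ = radiusOfRecordH N F.L (ne3NperOfRecord₁₁ F 0 0) ∧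
        (ℓ₃ F).C = constOfRecordH N F.L (ne3NperOfRecord₁₁ F 0 0) (g F) ∧
        0 < (ℓ₃ F).b ∧ 512 * (4 + 1) * (4 + 4) * (F.L : ℝ) ^ 2 * (ℓ₃ F).b ≤ 1 ∧ 0 < (ℓ₃ F).Λ₂' ∧
        InEndRegimeH (ne3OfRecord₁₁ F (ne3ConstLayerOfRecord₁₁ F N (ℓ₃ F))) ∧ LeafSlotHolderAT (ne3OfRecord₁₁ F (ne3ConstLayerOfRecord₁₁ F N (ℓ₃ F))) β :=
  exists_letters_s_N16Holder_readingOfRecord₁₃CoPHOn_of_edges_allTorus hβ0 hβ1 Rg w1 ne2 ne1 hg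
    (fun F => by
      obtain ⟨len, B₁', C₂, B₀β, inp, hlen, hlen1, hB₁', hBB, t4, p3⟩ := hP F
      exact h5_of_t4P_p3P F.hL.2 β hlen hlen1 hB₁' hBB t4 p3)
    h7

/-- **THE SAME AT THE CANONICAL READING OF RECORD** (`S_N16Holder β (RRec₁₃CoPH (readingOfRecord₁₃CoPH w1 ℓ₃ ne2 ne1))`). [cite: Balaban1985RegularSpaces, Thm 4 p.88, Prop. 3 p.87] [folklore] -/
theorem exists_letters_s_N16Holder_readingOfRecord₁₃CoPH_of_pConjuncts_allTorus {g : T4Family → ℝ} (hg : ∀ F, 0 < g F)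
    (hP : ∀ F : T4Family, letI : CStarAlgebra (Matrix (Fin N) (Fin N) ℂ) := {}
      ∃ (len : Site 4 → ℝ) (B₁' C₂ B₀β : ℝ) (inp : B8.B9Inputs),
        (∀ v : Site 4, 0 < len v → 1 ≤ len v) ∧ (∀ μ : Fin 4, len (e μ) = 1) ∧ 0 < B₁' ∧ 5 * ((4 : ℕ) : ℝ) * F.L * inp.B₀ ≤ B₁' ∧
        B8.Thm4Printed B₁' (fun j : {i : {i : ZdIdx 4 F.L // i.Ω 0 = Set.univ} // IdxB8LawsB F.L i.1} => (zdGF3P (Matrix (Fin N) (Fin N) ℂ) F.L β len j.1.1).toGFData) ∧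
        B8.Prop3Printed 4 (F.L : ℝ) C₂ inp B₀β (fun j : {i : {i : ZdIdx 4 F.L // i.Ω 0 = Set.univ} // IdxB8LawsB F.L i.1} => (zdGF3P (Matrix (Fin N) (Fin N) ℂ) F.L β len j.1.1).toGFData2))
    (h7 : ∀ F : T4Family, ∃ C ε₀ : ℝ, 0 ≤ C ∧ 0 < ε₀ ∧ ∀ ε : ℝ, 0 < ε → ε ≤ ε₀ →
      LeafH3sup 4 F.L (ne3NperOfRecord₁₁ F 0 0) ε (C * ε) (C * ε) (ne3DomOfRecord₁₁ F N 0 0)) :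
    ∃ ℓ₃ : T4Family → NE3Letters₁₁,
      S_N16Holder β (RRec₁₃CoPH (readingOfRecord₁₃CoPH w1 ℓ₃ ne2 ne1)) ∧
      ∀ F : T4Family, (ℓ₃ F).g = g F ∧ (ℓ₃ F).Λ₁ = radiusOfRecordH N F.L (ne3NperOfRecord₁₁ F 0 0) ∧
        (ℓ₃ F).C = constOfRecordH N F.L (ne3NperOfRecord₁₁ F 0 0) (g F) ∧
        0 < (ℓ₃ F).b ∧ 512 * (4 + 1) * (4 + 4) * (F.L : ℝ) ^ 2 * (ℓ₃ F).b ≤ 1 ∧ 0 < (ℓ₃ F).Λ₂' ∧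
        InEndRegimeH (ne3OfRecord₁₁ F (ne3ConstLayerOfRecord₁₁ F N (ℓ₃ F))) ∧ LeafSlotHolderAT (ne3OfRecord₁₁ F (ne3ConstLayerOfRecord₁₁ F N (ℓ₃ F))) β :=
  exists_letters_s_N16Holder_readingOfRecord₁₃CoPH_of_edges_allTorus hβ0 hβ1 w1 ne2 ne1 hg
    (fun F => by
      obtain ⟨len, B₁', C₂, B₀β, inp, hlen, hlen1, hB₁', hBB, t4, p3⟩ := hP F
      exact h5_of_t4P_p3P F.hL.2 β hlen hlen1 hB₁' hBB t4 p3)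
    h7

end Holder

/-! ## §2 β = 1: the stub of record `S_N16` -/

section One

variable (Rg : (F : T4Family) → Stage13HParams F N → Prop)
  (w1 : (F : T4Family) → (θ : Stage13HParams F N) → ReadingData F (MatA N) θ.τ9.M)
  (ne2 : (F : T4Family) → Stage13HParams F N → (ℕ → ℝ) → List (ULoop F) → ℕ → NE2Objects₁₁)
  (ne1 : (F : T4Family) → Stage13HParams F N → (ℕ → ℝ) → List (ULoop F) → NE1pCarriers)

/-- **N16 (β = 1) AT THE REGIME-RESTRICTED READING OF RECORD, NODE N05 READ AS ITS TWO P-CONJUNCTS** (Hölder exponent `1`): module 37ᴴ's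
`exists_letters_s_N16_readingOfRecord₁₃CoPHOn_of_edges_allTorus` with `h5 := h5_of_t4P_p3P` BY NAME.  Nothing of Bałaban is proved.
[cite: Balaban1985RegularSpaces, Thm 4 p.88, Prop. 3 p.87, p.77] [folklore] -/
theorem exists_letters_s_N16_readingOfRecord₁₃CoPHOn_of_pConjuncts_allTorus {g : T4Family → ℝ} (hg : ∀ F, 0 < g F)
    (hP : ∀ F : T4Family, letI : CStarAlgebra (Matrix (Fin N) (Fin N) ℂ) := {}
      ∃ (len : Site 4 → ℝ) (B₁' C₂ B₀β : ℝ) (inp : B8.B9Inputs),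
        (∀ v : Site 4, 0 < len v → 1 ≤ len v) ∧ (∀ μ : Fin 4, len (e μ) = 1) ∧ 0 < B₁' ∧ 5 * ((4 : ℕ) : ℝ) * F.L * inp.B₀ ≤ B₁' ∧
        B8.Thm4Printed B₁' (fun j : {i : {i : ZdIdx 4 F.L // i.Ω 0 = Set.univ} // IdxB8LawsB F.L i.1} => (zdGF3P (Matrix (Fin N) (Fin N) ℂ) F.L 1 len j.1.1).toGFData) ∧
        B8.Prop3Printed 4 (F.L : ℝ) C₂ inp B₀β (fun j : {i : {i : ZdIdx 4 F.L // i.Ω 0 = Set.univ} // IdxB8LawsB F.L i.1} => (zdGF3P (Matrix (Fin N) (Fin N) ℂ) F.L 1 len j.1.1).toGFData2))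
    (h7 : ∀ F : T4Family, ∃ C ε₀ : ℝ, 0 ≤ C ∧ 0 < ε₀ ∧ ∀ ε : ℝ, 0 < ε → ε ≤ ε₀ →
      LeafH3sup 4 F.L (ne3NperOfRecord₁₁ F 0 0) ε (C * ε) (C * ε) (ne3DomOfRecord₁₁ F N 0 0)) :
    ∃ ℓ₃ : T4Family → NE3Letters₁₁,
      S_N16 (RRec₁₃CoPHOn (readingOfRecord₁₃CoPH w1 ℓ₃ ne2 ne1) Rg) ∧
      ∀ F : T4Family, (ℓ₃ F).g = g F ∧ (ℓ₃ F).Λ₁ = radiusOfRecord N F.L (ne3NperOfRecord₁₁ F 0 0) ∧ (ℓ₃ F).C = constOfRecord N F.L (ne3NperOfRecord₁₁ F 0 0) (g F) ∧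
        0 < (ℓ₃ F).b ∧ 512 * (4 + 1) * (4 + 4) * (F.L : ℝ) ^ 2 * (ℓ₃ F).b ≤ 1 ∧ 0 < (ℓ₃ F).Λ₂' ∧
        InEndRegime (ne3OfRecord₁₁ F (ne3ConstLayerOfRecord₁₁ F N (ℓ₃ F))) ∧ LeafSlotAT (ne3OfRecord₁₁ F (ne3ConstLayerOfRecord₁₁ F N (ℓ₃ F))) :=
  exists_letters_s_N16_readingOfRecord₁₃CoPHOn_of_edges_allTorus Rg w1 ne2 ne1 hg
    (fun F => by
      obtain ⟨len, B₁', C₂, B₀β, inp, hlen, hlen1, hB₁', hBB, t4, p3⟩ := hP F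
      exact h5_of_t4P_p3P F.hL.2 1 hlen hlen1 hB₁' hBB t4 p3)
    h7

/-- **THE SAME AT THE CANONICAL READING OF RECORD** (`S_N16 (RRec₁₃CoPH (readingOfRecord₁₃CoPH w1 ℓ₃ ne2 ne1))`). [cite: Balaban1985RegularSpaces, Thm 4 p.88, Prop. 3 p.87] [folklore] -/
theorem exists_letters_s_N16_readingOfRecord₁₃CoPH_of_pConjuncts_allTorus {g : T4Family → ℝ} (hg : ∀ F, 0 < g F)
    (hP : ∀ F : T4Family, letI : CStarAlgebra (Matrix (Fin N) (Fin N) ℂ) := {}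
      ∃ (len : Site 4 → ℝ) (B₁' C₂ B₀β : ℝ) (inp : B8.B9Inputs),
        (∀ v : Site 4, 0 < len v → 1 ≤ len v) ∧ (∀ μ : Fin 4, len (e μ) = 1) ∧ 0 < B₁' ∧ 5 * ((4 : ℕ) : ℝ) * F.L * inp.B₀ ≤ B₁' ∧
        B8.Thm4Printed B₁' (fun j : {i : {i : ZdIdx 4 F.L // i.Ω 0 = Set.univ} // IdxB8LawsB F.L i.1} => (zdGF3P (Matrix (Fin N) (Fin N) ℂ) F.L 1 len j.1.1).toGFData) ∧
        B8.Prop3Printed 4 (F.L : ℝ) C₂ inp B₀β (fun j : {i : {i : ZdIdx 4 F.L // i.Ω 0 = Set.univ} // IdxB8LawsB F.L i.1} => (zdGF3P (Matrix (Fin N) (Fin N) ℂ) F.L 1 len j.1.1).toGFData2))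
    (h7 : ∀ F : T4Family, ∃ C ε₀ : ℝ, 0 ≤ C ∧ 0 < ε₀ ∧ ∀ ε : ℝ, 0 < ε → ε ≤ ε₀ →
      LeafH3sup 4 F.L (ne3NperOfRecord₁₁ F 0 0) ε (C * ε) (C * ε) (ne3DomOfRecord₁₁ F N 0 0)) :
    ∃ ℓ₃ : T4Family → NE3Letters₁₁,
      S_N16 (RRec₁₃CoPH (readingOfRecord₁₃CoPH w1 ℓ₃ ne2 ne1)) ∧
      ∀ F : T4Family, (ℓ₃ F).g = g F ∧ (ℓ₃ F).Λ₁ = radiusOfRecord N F.L (ne3NperOfRecord₁₁ F 0 0) ∧ (ℓ₃ F).C = constOfRecord N F.L (ne3NperOfRecord₁₁ F 0 0) (g F) ∧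
        0 < (ℓ₃ F).b ∧ 512 * (4 + 1) * (4 + 4) * (F.L : ℝ) ^ 2 * (ℓ₃ F).b ≤ 1 ∧ 0 < (ℓ₃ F).Λ₂' ∧
        InEndRegime (ne3OfRecord₁₁ F (ne3ConstLayerOfRecord₁₁ F N (ℓ₃ F))) ∧ LeafSlotAT (ne3OfRecord₁₁ F (ne3ConstLayerOfRecord₁₁ F N (ℓ₃ F))) :=
  exists_letters_s_N16_readingOfRecord₁₃CoPH_of_edges_allTorus w1 ne2 ne1 hg
    (fun F => by
      obtain ⟨len, B₁', C₂, B₀β, inp, hlen, hlen1, hB₁', hBB, t4, p3⟩ := hP F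
      exact h5_of_t4P_p3P F.hL.2 1 hlen hlen1 hB₁' hBB t4 p3)
    h7

end One

/-! ## §3 R-β″ (MS length letter): `S_N16HolderMS β`, `0 ≤ β ≤ 1` -/

section MS

variable {β : ℝ} (hβ0 : 0 ≤ β) (hβ1 : β ≤ 1)
variable (Rg : (F : T4Family) → Stage13HParams F N → Prop)
  (w1 : (F : T4Family) → (θ : Stage13HParams F N) → ReadingData F (MatA N) θ.τ9.M)
  (ne2 : (F : T4Family) → Stage13HParams F N → (ℕ → ℝ) → List (ULoop F) → ℕ → NE2Objects₁₁)
  (ne1 : (F : T4Family) → Stage13HParams F N → (ℕ → ℝ) → List (ULoop F) → NE1pCarriers)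
include hβ0 hβ1

/-- **N16 UNDER R-β″ AT THE REGIME-RESTRICTED READING OF RECORD, NODE N05 READ AS ITS TWO P-CONJUNCTS** (`0 ≤ β ≤ 1`, MS length letter `len (j • e_μ) = j`): module 37ᴴ's
`exists_letters_s_N16HolderMS_readingOfRecord₁₃CoPHOn_of_edges_allTorus` with `h5 := h5MS_of_t4P_p3P` BY NAME.  Nothing of Bałaban is proved.
[cite: Balaban1985RegularSpaces, Thm 4 p.88, Prop. 3 p.87, p.77] [folklore] -/
theorem exists_letters_s_N16HolderMS_readingOfRecord₁₃CoPHOn_of_pConjuncts_allTorus {g : T4Family → ℝ} (hg : ∀ F, 0 < g F)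
    (hP : ∀ F : T4Family, letI : CStarAlgebra (Matrix (Fin N) (Fin N) ℂ) := {}
      ∃ (len : Site 4 → ℝ) (B₁' C₂ B₀β : ℝ) (inp : B8.B9Inputs),
        (∀ v : Site 4, 0 < len v → 1 ≤ len v) ∧ (∀ (μ : Fin 4) (j : ℕ), len (j • e μ) = j) ∧ 0 < B₁' ∧ 5 * ((4 : ℕ) : ℝ) * F.L * inp.B₀ ≤ B₁' ∧
        B8.Thm4Printed B₁' (fun j : {i : {i : ZdIdx 4 F.L // i.Ω 0 = Set.univ} // IdxB8LawsB F.L i.1} => (zdGF3P (Matrix (Fin N) (Fin N) ℂ) F.L β len j.1.1).toGFData) ∧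
        B8.Prop3Printed 4 (F.L : ℝ) C₂ inp B₀β (fun j : {i : {i : ZdIdx 4 F.L // i.Ω 0 = Set.univ} // IdxB8LawsB F.L i.1} => (zdGF3P (Matrix (Fin N) (Fin N) ℂ) F.L β len j.1.1).toGFData2))
    (h7 : ∀ F : T4Family, ∃ C ε₀ : ℝ, 0 ≤ C ∧ 0 < ε₀ ∧ ∀ ε : ℝ, 0 < ε → ε ≤ ε₀ →
      LeafH3sup 4 F.L (ne3NperOfRecord₁₁ F 0 0) ε (C * ε) (C * ε) (ne3DomOfRecord₁₁ F N 0 0)) :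
    ∃ ℓ₃ : T4Family → NE3Letters₁₁,
      S_N16HolderMS β (RRec₁₃CoPHOn (readingOfRecord₁₃CoPH w1 ℓ₃ ne2 ne1) Rg) ∧
      ∀ F : T4Family, (ℓ₃ F).g = g F ∧ (ℓ₃ F).Λ₁ = radiusOfRecordHMS N F.L (ne3NperOfRecord₁₁ F 0 0) ∧
        (ℓ₃ F).C = constOfRecordHMS N F.L (ne3NperOfRecord₁₁ F 0 0) (g F) ∧
        0 < (ℓ₃ F).b ∧ 512 * (4 + 1) * (4 + 4) * (F.L : ℝ) ^ 2 * (ℓ₃ F).b ≤ 1 ∧ 0 < (ℓ₃ F).Λ₂' ∧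
        InEndRegimeHMS (ne3OfRecord₁₁ F (ne3ConstLayerOfRecord₁₁ F N (ℓ₃ F))) ∧ LeafSlotHolderMSAT (ne3OfRecord₁₁ F (ne3ConstLayerOfRecord₁₁ F N (ℓ₃ F))) β :=
  exists_letters_s_N16HolderMS_readingOfRecord₁₃CoPHOn_of_edges_allTorus hβ0 hβ1 Rg w1 ne2 ne1 hg
    (fun F => by
      obtain ⟨len, B₁', C₂, B₀β, inp, hlen, hlenj, hB₁', hBB, t4, p3⟩ := hP F
      exact h5MS_of_t4P_p3P F.hL.2 β hlen hlenj hB₁' hBB t4 p3)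
    h7

/-- **THE SAME AT THE CANONICAL READING OF RECORD** (`S_N16HolderMS β (RRec₁₃CoPH (readingOfRecord₁₃CoPH w1 ℓ₃ ne2 ne1))`). [cite: Balaban1985RegularSpaces, Thm 4 p.88, Prop. 3 p.87] [folklore] -/
theorem exists_letters_s_N16HolderMS_readingOfRecord₁₃CoPH_of_pConjuncts_allTorus {g : T4Family → ℝ} (hg : ∀ F, 0 < g F)
    (hP : ∀ F : T4Family, letI : CStarAlgebra (Matrix (Fin N) (Fin N) ℂ) := {}
      ∃ (len : Site 4 → ℝ) (B₁' C₂ B₀β : ℝ) (inp : B8.B9Inputs),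
        (∀ v : Site 4, 0 < len v → 1 ≤ len v) ∧ (∀ (μ : Fin 4) (j : ℕ), len (j • e μ) = j) ∧ 0 < B₁' ∧ 5 * ((4 : ℕ) : ℝ) * F.L * inp.B₀ ≤ B₁' ∧
        B8.Thm4Printed B₁' (fun j : {i : {i : ZdIdx 4 F.L // i.Ω 0 = Set.univ} // IdxB8LawsB F.L i.1} => (zdGF3P (Matrix (Fin N) (Fin N) ℂ) F.L β len j.1.1).toGFData) ∧
        B8.Prop3Printed 4 (F.L : ℝ) C₂ inp B₀β (fun j : {i : {i : ZdIdx 4 F.L // i.Ω 0 = Set.univ} // IdxB8LawsB F.L i.1} => (zdGF3P (Matrix (Fin N) (Fin N) ℂ) F.L β len j.1.1).toGFData2))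
    (h7 : ∀ F : T4Family, ∃ C ε₀ : ℝ, 0 ≤ C ∧ 0 < ε₀ ∧ ∀ ε : ℝ, 0 < ε → ε ≤ ε₀ →
      LeafH3sup 4 F.L (ne3NperOfRecord₁₁ F 0 0) ε (C * ε) (C * ε) (ne3DomOfRecord₁₁ F N 0 0)) :
    ∃ ℓ₃ : T4Family → NE3Letters₁₁,
      S_N16HolderMS β (RRec₁₃CoPH (readingOfRecord₁₃CoPH w1 ℓ₃ ne2 ne1)) ∧
      ∀ F : T4Family, (ℓ₃ F).g = g F ∧ (ℓ₃ F).Λ₁ = radiusOfRecordHMS N F.L (ne3NperOfRecord₁₁ F 0 0) ∧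
        (ℓ₃ F).C = constOfRecordHMS N F.L (ne3NperOfRecord₁₁ F 0 0) (g F) ∧
        0 < (ℓ₃ F).b ∧ 512 * (4 + 1) * (4 + 4) * (F.L : ℝ) ^ 2 * (ℓ₃ F).b ≤ 1 ∧ 0 < (ℓ₃ F).Λ₂' ∧
        InEndRegimeHMS (ne3OfRecord₁₁ F (ne3ConstLayerOfRecord₁₁ F N (ℓ₃ F))) ∧ LeafSlotHolderMSAT (ne3OfRecord₁₁ F (ne3ConstLayerOfRecord₁₁ F N (ℓ₃ F))) β :=
  exists_letters_s_N16HolderMS_readingOfRecord₁₃CoPH_of_edges_allTorus hβ0 hβ1 w1 ne2 ne1 hg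
    (fun F => by
      obtain ⟨len, B₁', C₂, B₀β, inp, hlen, hlenj, hB₁', hBB, t4, p3⟩ := hP F
      exact h5MS_of_t4P_p3P F.hL.2 β hlen hlenj hB₁' hBB t4 p3)
    h7

end MS

end

end Summit.QuantumFields.YangMills.BalabanUVNodes.N16OfPConjunctsAllTorusAtRecord13CoPH
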